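import Summits.Ventures.PercRepro.RankLevelSetLevelFiveCqSeventeen
import Summits.Ventures.PercRepro.S1RowEleven
import Summits.Ventures.PercRepro.S2CoreFifteen
import Summits.Ventures.PercRepro.S2CellsP15A
import Summits.Ventures.PercRepro.S2CellsP15K

/-!
# PercRepro — THE `p = 15` ROW AT CORANK `≥ 17`, AND THEOREM C₅ AT `16` MODULO THE SMALL CELLS (p7, gen 11; sub-claim S2; the «16» assembly, conditional)

The `p = 15` row of the `q = 5` window where the kit reaches: the plain cells `(15, 17 … 23)` on the quart core with the exact
`Φ(15, 5) = 389/6` (S2CellsP15A), the tail-free key cells `(15, 24 … 37)` (S2CellsP15K) and corank `≥ 38` by the sum key at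
`n₀ = 53` (S2CoreFifteen) — **`c025_core_five_fifteen_xx`** (`17 ≤ d ≤ 37`) and **`c025_core_five_fifteen_ge_seventeen`**
(every corank `≥ 17`). What is NOT here: the eleven cells `(15, 6 … 16)` — priced OPEN with the kit's levers
(lean-drafts/p7/g11/mining/: the plain cells read `1.03 … 1.50`, the nested dichotomy closes only `(15, 15)`, the cobasis-T /
XMid cores `1.04 / 1.03`). They enter as ONE hypothesis `hsmall`:
* **`c025_five_of_four_cq_xvi_from`** — level `4` for all `p ≥ P ≥ 15` and the small cells imply level `5` for all `p ≥ P + 1`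
  (the `p = 15` row here; `p ≥ 16` by the «17» assembly's `c025_five_of_four_cq_xvii_from`);
* **`c025_five_large_sharp16_of_small_cells`** — THEOREM C₅ AT `16` MODULO THE SMALL CELLS: with level `4` from S1's
  `c025_four_eleven`, C-025 at level `5` for every `p ≥ 16` — the window move «8 ≤ p ≤ 16» → «8 ≤ p ≤ 15» hinges on `hsmall` alone;
  `c025_five_large_sharp16_of_small_cells'` is the `C025` spelling. Nothing here asserts the move.
Axioms: standard.
-/

open scoped Matroid

namespace PercRepro

namespace ThmN

open Set

variable {α : Type}

/-- **The `e`-free core at level `5`, rank `15`, every corank `17 ≤ d ≤ 37`** (the plain cells `17 … 23`, the key cells `24 … 37`). -/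
theorem c025_core_five_fifteen_xx (M : Matroid α) [M.Finite] (d : ℕ)
    (hd17 : 17 ≤ d) (hd37 : d ≤ 37) (hR : M.eRank = ((15 : ℕ) : ℕ∞)) (hn : M.E.ncard = 15 + d)
    (hfree : ∀ e ∈ M.E, ∃ A ⊆ M.E \ {e}, e ∉ M.closure A ∧ e ∉ M.closure ((M.E \ {e}) \ A)) :
    RLS M 15 5 := by
  interval_cases d
  · exact c025_fifteen_17 M hR hn hfree
  · exact c025_fifteen_18 M hR hn hfree
  · exact c025_fifteen_19 M hR hn hfree
  · exact c025_fifteen_20 M hR hn hfree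
  · exact c025_fifteen_21 M hR hn hfree
  · exact c025_fifteen_22 M hR hn hfree
  · exact c025_fifteen_23 M hR hn hfree
  · exact c025_fifteen_24 M hR hn hfree
  · exact c025_fifteen_25 M hR hn hfree
  · exact c025_fifteen_26 M hR hn hfree
  · exact c025_fifteen_27 M hR hn hfree
  · exact c025_fifteen_28 M hR hn hfree
  · exact c025_fifteen_29 M hR hn hfree
  · exact c025_fifteen_30 M hR hn hfree
  · exact c025_fifteen_31 M hR hn hfree
  · exact c025_fifteen_32 M hR hn hfree
  · exact c025_fifteen_33 M hR hn hfree
  · exact c025_fifteen_34 M hR hn hfree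
  · exact c025_fifteen_35 M hR hn hfree
  · exact c025_fifteen_36 M hR hn hfree
  · exact c025_fifteen_37 M hR hn hfree

/-- **The `e`-free core at level `5`, rank `15`, every corank `≥ 17`** (`17 ≤ d ≤ 37` cell by cell, `d ≥ 38` by the sum key). -/
theorem c025_core_five_fifteen_ge_seventeen (M : Matroid α) [M.Finite]
    (hR : M.eRank = ((15 : ℕ) : ℕ∞)) (hbig : 15 + 16 < M.E.ncard)
    (hfree : ∀ e ∈ M.E, ∃ A ⊆ M.E \ {e}, e ∉ M.closure A ∧ e ∉ M.closure ((M.E \ {e}) \ A)) :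
    RLS M 15 5 := by
  rcases Nat.lt_or_ge M.E.ncard (15 + 38) with h | h
  · exact c025_core_five_fifteen_xx M (M.E.ncard - 15) (by omega) (by omega) hR (by omega) hfree
  · exact c025_core_five_at_fifteen_big M (by omega) hfree

/-- **THEOREM C₅, GIVEN LEVEL `4` FROM `P ≥ 15` AND THE SMALL CELLS OF THE `p = 15` ROW**: level `4` for all `p ≥ P` and
`RLS M 15 5` on every `e`-free core of rank `15` and corank `6 ≤ d ≤ 16` (`hsmall`) imply level `5` for all `p ≥ P + 1`
(the `p = 15` row by `hsmall` / `c025_core_five_fifteen_ge_seventeen`, the rows `p ≥ 16` by the «17» assembly). -/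
theorem c025_five_of_four_cq_xvi_from (P : ℕ) (hP : 15 ≤ P)
    (h4 : ∀ (M : Matroid α) [M.Finite] (p : ℕ), P ≤ p → RLS M p 4)
    (hsmall : ∀ (M : Matroid α) [M.Finite] (d : ℕ), 6 ≤ d → d ≤ 16 → M.eRank = ((15 : ℕ) : ℕ∞) →
      M.E.ncard = 15 + d →
      (∀ e ∈ M.E, ∃ A ⊆ M.E \ {e}, e ∉ M.closure A ∧ e ∉ M.closure ((M.E \ {e}) \ A)) → RLS M 15 5) :
    ∀ (M : Matroid α) [M.Finite] (p : ℕ), P + 1 ≤ p → RLS M p 5 := by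
  rcases Nat.lt_or_ge P 16 with hP15 | hP16
  · have hP' : P = 15 := by omega
    subst hP'
    refine S2.rls_five_of_four_of_core 15 (by omega) h4 ?_
    intro M _ p hP' hR hbig hfree
    rcases Nat.lt_or_ge p 16 with h15 | h16
    · have hp' : p = 15 := by omega
      subst hp'
      rcases Nat.lt_or_ge M.E.ncard (15 + 17) with h | h
      · exact hsmall M (M.E.ncard - 15) (by omega) (by omega) hR (by omega) hfree
      · exact c025_core_five_fifteen_ge_seventeen M hR (by omega) hfree
    rcases Nat.lt_or_ge p 17 with h16' | h17
    · have hp' : p = 16 := by omega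
      subst hp'
      rcases Nat.lt_or_ge M.E.ncard (16 + 34) with h | h
      · exact c025_core_five_sixteen_xx M (M.E.ncard - 16) (by omega) (by omega) hR (by omega) hfree
      · exact c025_core_five_at_sixteen_big M (by omega) hfree
    · exact c025_five_of_four_cq_xvii_from 16 le_rfl (fun M _ p hp => h4 M p (by omega)) M p h17
  · exact c025_five_of_four_cq_xvii_from P hP16 h4

/-- **THEOREM C₅ AT `16` MODULO THE SMALL CELLS**: if every `e`-free core of rank `15` and corank `6 ≤ d ≤ 16` satisfies
`RLS M 15 5`, then every finite matroid satisfies C-025 at level `5` for every `p ≥ 16` (level `4` from S1's `c025_four_eleven`). -/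
theorem c025_five_large_sharp16_of_small_cells
    (hsmall : ∀ (M : Matroid α) [M.Finite] (d : ℕ), 6 ≤ d → d ≤ 16 → M.eRank = ((15 : ℕ) : ℕ∞) →
      M.E.ncard = 15 + d →
      (∀ e ∈ M.E, ∃ A ⊆ M.E \ {e}, e ∉ M.closure A ∧ e ∉ M.closure ((M.E \ {e}) \ A)) → RLS M 15 5)
    (M : Matroid α) [M.Finite] (p : ℕ) (hp : 16 ≤ p) : RLS M p 5 :=
  c025_five_of_four_cq_xvi_from 15 le_rfl (fun M _ p hp => S1.c025_four_eleven M p (by omega)) hsmall M p hp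

/-- The conditional level-`5` statement at `p ≥ 16` in the vocabulary of `C025`. -/
theorem c025_five_large_sharp16_of_small_cells'
    (hsmall : ∀ (M : Matroid α) [M.Finite] (d : ℕ), 6 ≤ d → d ≤ 16 → M.eRank = ((15 : ℕ) : ℕ∞) →
      M.E.ncard = 15 + d →
      (∀ e ∈ M.E, ∃ A ⊆ M.E \ {e}, e ∉ M.closure A ∧ e ∉ M.closure ((M.E \ {e}) \ A)) → RLS M 15 5)
    (M : Matroid α) [M.Finite] (p : ℕ) (hp : 16 ≤ p) :
    phiK p 5 * ({A : Set α | A ⊆ M.E ∧ M.eRk A = (p : ℕ∞) ∧ M.eRk (M.E \ A) = (5 : ℕ∞)}.ncard : ℚ) ≤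
      ({A : Set α | A ⊆ M.E ∧ (5 : ℕ∞) < M.eRk A ∧ M.eRk A < (p : ℕ∞)}.ncard : ℚ) :=
  c025_five_large_sharp16_of_small_cells hsmall M p hp

end ThmN

end PercRepro
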